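import Summits.ResolutionOfSingularities.ResolutionOfSingularities.Theorems.LossEntryW23
import Summits.ResolutionOfSingularities.ResolutionOfSingularities.Theorems.LossEntryW27
import Summits.ResolutionOfSingularities.ResolutionOfSingularities.Theorems.LossEntryW28
import Summits.ResolutionOfSingularities.ResolutionOfSingularities.Theorems.LossEntryW29
import Summits.ResolutionOfSingularities.ResolutionOfSingularities.Theorems.LossEntryW30

/-!
# Loss entry, walk level — part 32: THE CHAIN DATA AND THE STEPS h3, h2 OF THE DATA SKELETON (decomp-res lens-3, g29)

NODE-g29 §3ter, ASSEMBLY of the loss-chain half of `LawLossEntry` (residual `stmt-ResolutionOfSingularities-27367`,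
lossy cell).  The data skeleton `lawLossEntryAt_of_wallSteps_data` (part 31) is fed with

* `D := WallFrame K` — wall letter `a`, section letter `x`, ceiling letter `y`, in-wall root `μ`;
* `P := WallP` — «`v > N` is a heavy one-wall state on `a` whose in-wall slice of the lowest layer is `φ·(u_y − μ u_x)^s`, `φ ≠ 0`»;
* `B := WallB` — the ordinate `ŷ` of the one-wall polygon in the frame `(a ; x, y)` after the straightening `σ_{y,x,μ}`.

This part proves the END step **h3** (`wallSteps_h3`: a staying move from a `P`-state points at the in-wall root —
END′ `b_eq_root_of_wall_pure_stays` (part 26/29), the degenerate position never stays `wall_axis_not_stays` — so `B`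
IS the wall ordinate of `runBeta_lt_wallOrd_of_repeat` (part 12), in either orientation by (S3′)) and the PROPAGATION
step **h2** (`wallSteps_h2`, by the chart letter: α-step `wall_pure_succ_alpha` + (S1′); β-step `wall_pure_succ` + (S2″)
with `τ' :=` the NEW root, whose effective source parameter is the OLD root; ceiling chart with `μ ≠ 0`: reorient
(`wall_pure_reorient`, (S3′)) then β-step; ceiling chart with `μ = 0`: `wall_axis_succ` + (S4)).  Part 33 proves the
START step h1 and concludes.

Tree tools only; complete proofs, standard axioms.

(Sources: Hauser2010 §F; HauserPerlega2019 §2; CossartJannsenSaito2020 Ch. 8, Lemma 13.4; Moh1987; Perlega2022.)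
-/

open MvPolynomial Finset
open Literature.AlgebraicGeometry.Resolution
open Literature.AlgebraicGeometry.Resolution.Hauser2010
open Literature.AlgebraicGeometry.Resolution.PointBlowup
open Summit.ResolutionOfSingularities.ResolutionOfSingularities.Theorems.TightDefectClasses
open Summit.ResolutionOfSingularities.ResolutionOfSingularities.Theorems.TightDefectStrongWalks
open Summit.ResolutionOfSingularities.ResolutionOfSingularities.Theorems.ItineraryCutClasses
open Summit.ResolutionOfSingularities.ResolutionOfSingularities.Theorems.BoundaryLedger
open Summit.ResolutionOfSingularities.ResolutionOfSingularities.Theorems.ProximityCut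
open Summit.ResolutionOfSingularities.ResolutionOfSingularities.Theorems.ConeCut
open Summit.ResolutionOfSingularities.ResolutionOfSingularities.Theorems.LossExitCone
open Summit.ResolutionOfSingularities.ResolutionOfSingularities.Theorems.LossPolygon

namespace Summit.ResolutionOfSingularities.ResolutionOfSingularities.Theorems.LossEpisode

section ChainAssembly

variable {K : Type} [Field K] [DecidableEq K] {q : ℕ} {s₀ : State (Fin 3) K}

/-- **CHAIN DATA** carried along a loss chain (NODE-g29 §3ter): the wall letter `a`, the section letter `x`, the
ceiling letter `y` and the in-wall root `μ` — «the in-wall slice of the lowest layer is `φ·(u_y − μ·u_x)^s`». [new] -/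
structure WallFrame (K : Type) where
  /-- wall letter -/
  a : Fin 3
  /-- section letter -/
  x : Fin 3
  /-- ceiling letter -/
  y : Fin 3
  /-- in-wall root -/
  μ : K

/-- **THE CHAIN INVARIANT** `P v d`: `v > N` is a one-wall tail state on the letter `d.a` with heavy order
(`q < s + M`), and its in-wall slice of the lowest layer is a non-zero multiple of `(u_y − μ u_x)^s`. [new] -/
def WallP (W : ForcedWalk q s₀) (N s v : ℕ) (d : WallFrame K) : Prop :=
  d.a ≠ d.x ∧ d.a ≠ d.y ∧ d.x ≠ d.y ∧ N < v ∧
    (∃ M : ℕ, (W.st v).r = Finsupp.single d.a M ∧ q < s + M) ∧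
    ∃ φ : K, φ ≠ 0 ∧ ∀ E : Fin 3 →₀ ℕ, E.degree = s → E d.a = 0 →
      coeff ((W.st v).r + E) (W.st v).F = φ * coeff E ((X d.y - C d.μ * X d.x) ^ s)

/-- **THE POTENTIAL** `B v d`: the ordinate `ŷ` of the lex-min vertex of the one-wall polygon of `F_v` in the frame
`(a ; x, y)` after the straightening `u_y ↦ u_y + μ·u_x`. [new] -/
noncomputable def WallB (W : ForcedWalk q s₀) (s v : ℕ) (d : WallFrame K) : ℚ :=
  betaOf (polyPts s (W.st v).r d.a d.x d.y (deletePthPowers q (shear d.y d.x d.μ (W.st v).F)))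

variable {W : ForcedWalk q s₀} {N s : ℕ}

/-- All monomials of a walk state of shade `s` and boundary `M·e_a` have degree `≥ M + s`. [folklore] -/
theorem le_degree_of_wall (hroot : IsRoot q s₀) (hT : TailHyp W N s) {v : ℕ} (hNv : N ≤ v) {a : Fin 3} {M : ℕ}
    (hr : (W.st v).r = Finsupp.single a M) : ∀ D ∈ (W.st v).F.support, M + s ≤ D.degree := by
  obtain ⟨o, ho, -⟩ := walk_nat hroot W v
  obtain ⟨n, hn, hon⟩ := order_eq_shade_add_degree hroot W v ho
  have hns : n = s := by have h := hn.symm.trans (hT.shade v hNv); exact_mod_cast h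
  have hrdeg : (W.st v).r.degree = M := by rw [hr, Finsupp.degree_single]
  intro D hD
  by_contra hlt
  push Not at hlt
  have h := (natCast_le_ordZero_iff_forall_coeff (W.st v).F o).mp (by rw [ho]) D (by rw [hon, hns, hrdeg]; omega)
  exact (MvPolynomial.mem_support_iff.mp hD) h

/-- Re-orientation of the in-wall purity hypothesis (`μ ≠ 0`): root `μ` in the frame `(a; x, y)` is root `μ⁻¹` in
the frame `(a; y, x)`. [folklore] -/
theorem wall_pure_reorient {v : ℕ} {a x y : Fin 3} {φ μ : K} (hμ : μ ≠ 0)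
    (hwall : ∀ E : Fin 3 →₀ ℕ, E.degree = s → E a = 0 →
      coeff ((W.st v).r + E) (W.st v).F = φ * coeff E ((X y - C μ * X x) ^ s)) :
    ∀ E : Fin 3 →₀ ℕ, E.degree = s → E a = 0 →
      coeff ((W.st v).r + E) (W.st v).F = (φ * (-μ) ^ s) * coeff E ((X x - C μ⁻¹ * X y) ^ s) := by
  intro E hE hEa
  rw [hwall E hE hEa, ← coeff_C_mul, ← coeff_C_mul, pure_pow_reorient φ μ hμ s]

/-- **THE END STEP (h3) OF THE DATA SKELETON (PROVED):** after the staying move at `v+1` from a chain state with data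
`d`, the proximity repeat's run state reads `β_{v+2} < B (v+1) d`.  Chart `x`: END′ (`b_eq_root_of_wall_pure_stays`)
gives `b_{v+1}(y) = μ`, so `wallOrd = B` and (h3′) `runBeta_lt_wallOrd_of_repeat` concludes; chart `y`: `μ ≠ 0` (the
degenerate position never stays, `wall_axis_not_stays`), re-orient (`pure_pow_reorient`), END′ gives `b_{v+1}(x) = μ⁻¹`,
and the two straightened readings agree (`betaOf_polyPts_two_frames_walk`). [new] -/
theorem wallSteps_h3 (hroot : IsRoot q s₀) (hT : TailHyp W N s)
    (hLucas : ∀ D T : ℕ, q ∣ D → ¬ q ∣ T → ((D.choose T : ℕ) : K) = 0) {v : ℕ} (hNv : N ≤ v)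
    (hloss : IsLossMove W v) (hst : StaysOnNewest W v) (d : WallFrame K) (hP : WallP W N s (v + 1) d)
    {l' : Fin 3} {d₀ T : ℕ} (hS' : IsRunState W s (v + 2) (W.j (v + 1)) (W.j v) l' d₀ T) :
    runBeta W s (v + 2) (W.j (v + 1)) (W.j v) l' < WallB W s (v + 1) d := by
  classical
  obtain ⟨hax, hay, hxy, -, ⟨M, hr, hqM⟩, φ, hφ, hwall⟩ := hP
  obtain ⟨T₀, -, h1T₀, hr1, -, -⟩ := lossMove_next hroot hT hNv hloss
  -- the wall letter is the previous chart letter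
  have hM1 : 1 ≤ M := by have := hT.s_lt; omega
  have haj : d.a = W.j v := by
    by_contra h
    have h1 := congrArg (fun r : Fin 3 →₀ ℕ => r d.a) hr
    rw [hr1, Finsupp.single_eq_same, Finsupp.single_eq_of_ne h] at h1
    omega
  have hga : W.b (v + 1) d.a = 0 := by rw [haj]; exact hst.2
  have hjx : W.j (v + 1) ≠ d.a := by rw [haj]; exact hst.1
  have hsh : (W.st (v + 1)).shade = (s : ℕ∞) := hT.shade (v + 1) (by omega)
  have hplat : (W.st (v + 1 + 1)).shade = (W.st (v + 1)).shade := by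
    rw [hT.shade (v + 1 + 1) (by omega), hsh]
  have hlt := le_degree_of_wall hroot hT (by omega : N ≤ v + 1) hr
  have hh3 := runBeta_lt_wallOrd_of_repeat hroot hT hNv hloss hst hS'
  have hl'1 : l' ≠ W.j (v + 1) := hS'.2.1
  have hl'a : l' ≠ d.a := by rw [haj]; exact hS'.2.2.1
  have hra : (W.st (v + 1)).r d.a = M := by rw [hr, Finsupp.single_eq_same]
  have hrx : (W.st (v + 1)).r d.x = 0 := by rw [hr, Finsupp.single_eq_of_ne hax.symm]
  have hry : (W.st (v + 1)).r d.y = 0 := by rw [hr, Finsupp.single_eq_of_ne hay.symm]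
  rcases fin3_eq_or d.a d.x d.y (W.j (v + 1)) hax hay hxy with hj | hj | hj
  · exact absurd hj hjx
  · -- chart `x`: the straight END′
    have hl'y : l' = d.y := by
      rcases fin3_eq_or d.a d.x d.y l' hax hay hxy with h | h | h
      · exact absurd h hl'a
      · exact absurd h (by rw [← hj]; exact hl'1)
      · exact h
    have hby : W.b (v + 1) d.y = d.μ :=
      b_eq_root_of_wall_pure_stays hroot W (v + 1) hax hay hxy hj hT.one_le hr hsh hplat hqM hga hφ hwall
    have hBW : WallB W s (v + 1) d = wallOrd W s (v + 1) (W.j v) (W.j (v + 1)) l' := by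
      unfold WallB wallOrd
      rw [← haj, hj, hl'y, hby]
    rw [hBW]
    exact hh3
  · -- chart `y`: the degenerate root cannot stay, so `μ ≠ 0`; re-orient
    have hμ : d.μ ≠ 0 := by
      intro hμ0
      have hwall0 : ∀ E : Fin 3 →₀ ℕ, E.degree = s → E d.a = 0 →
          coeff ((W.st (v + 1)).r + E) (W.st (v + 1)).F = φ * coeff E (X d.y ^ s) := by
        intro E hE hEa
        rw [hwall E hE hEa, hμ0, C_0, zero_mul, sub_zero]
      exact wall_axis_not_stays hroot W (v + 1) hay hax (Ne.symm hxy) hj hT.one_le hr hsh hplat hqM hφ hwall0 hga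
    have hl'x : l' = d.x := by
      rcases fin3_eq_or d.a d.x d.y l' hax hay hxy with h | h | h
      · exact absurd h hl'a
      · exact h
      · exact absurd h (by rw [← hj]; exact hl'1)
    have hwall' := wall_pure_reorient (W := W) hμ hwall
    have hbx : W.b (v + 1) d.x = d.μ⁻¹ :=
      b_eq_root_of_wall_pure_stays hroot W (v + 1) hay hax (Ne.symm hxy) hj hT.one_le hr hsh hplat hqM hga
        (mul_ne_zero hφ (pow_ne_zero _ (neg_ne_zero.mpr hμ))) hwall'
    have h2 := (betaOf_polyPts_two_frames_walk hroot W (v + 1) hax hay hxy hLucas (inv_mul_cancel₀ hμ) hlt hra hrx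
      hry (by rw [hra]; omega)).1
    have hBW : WallB W s (v + 1) d = wallOrd W s (v + 1) (W.j v) (W.j (v + 1)) l' := by
      unfold WallB wallOrd
      rw [← haj, hj, hl'x, hbx, h2]
    rw [hBW]
    exact hh3

/-- A walk state is clean: `clean(F_v) = F_v` (no `q`-th power exponents in its support). [folklore] -/
theorem deletePthPowers_walk (hroot : IsRoot q s₀) (v : ℕ) : deletePthPowers q (W.st v).F = (W.st v).F := by
  classical
  ext d
  rw [coeff_deletePthPowers]
  by_cases h : IsPthPowerExponent q d
  · rw [if_pos h]
    by_contra hne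
    exact not_isPthPowerExponent_of_mem_support hroot W v (MvPolynomial.mem_support_iff.mpr (Ne.symm hne)) h
  · rw [if_neg h]

/-- **THE α-STEP (h2, chart = wall letter) OF THE DATA SKELETON (PROVED):** the data are kept (`wall_pure_succ_alpha`)
and the straightened ordinate does not increase (`betaOf_polyPts_straightened_succ_alpha_le'`, any `τ`). [new] -/
theorem wallSteps_h2_alpha (hroot : IsRoot q s₀) (hT : TailHyp W N s)
    (hLucas : ∀ D T : ℕ, q ∣ D → ¬ q ∣ T → ((D.choose T : ℕ) : K) = 0) {v : ℕ} (d : WallFrame K)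
    (hP : WallP W N s v d) (hloss : IsLossMove W v) (hj : W.j v = d.a) :
    WallP W N s (v + 1) d ∧ WallB W s (v + 1) d ≤ WallB W s v d := by
  classical
  obtain ⟨hax, hay, hxy, hNv, ⟨M, hr, hqM⟩, φ, hφ, hwall⟩ := hP
  obtain ⟨T, hoT, h1T, hr1, hqT, -⟩ := lossMove_next hroot hT (by omega : N ≤ v) hloss
  rw [hj] at hr1
  have hsh : (W.st v).shade = (s : ℕ∞) := hT.shade v (by omega)
  have hplat : (W.st (v + 1)).shade = (W.st v).shade := by rw [hT.shade (v + 1) (by omega), hsh]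
  -- `T + q = s + M`
  obtain ⟨o, ho, -⟩ := walk_nat hroot W v
  obtain ⟨n, hn, hon⟩ := order_eq_shade_add_degree hroot W v ho
  have hns : n = s := by have h := hn.symm.trans hsh; exact_mod_cast h
  have hrdeg : (W.st v).r.degree = M := by rw [hr, Finsupp.degree_single]
  have hTq : q + T = s + M := by
    have h := ho.symm.trans hoT
    have h' : o = q + T := by exact_mod_cast h
    omega
  refine ⟨⟨hax, hay, hxy, by omega, ⟨T, hr1, by omega⟩, bUnit W v * φ, mul_ne_zero (bUnit_ne_zero W v) hφ,
    fun E hE hEa => wall_pure_succ_alpha hroot W v hax hay hj hr hsh hplat hqM hwall E hEa hE⟩, ?_⟩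
  unfold WallB
  exact betaOf_polyPts_straightened_succ_alpha_le' hroot W v hax hay hxy hj hLucas d.μ
    (by rw [hr1, hr, Finsupp.single_eq_of_ne hax.symm, Finsupp.single_eq_of_ne hax.symm])
    (by rw [hr1, hr, Finsupp.single_eq_same, Finsupp.single_eq_same, Finsupp.single_eq_of_ne hax.symm]; omega)
    (by rw [hr, Finsupp.single_eq_of_ne hay.symm]) (by rw [hr1, Finsupp.single_eq_of_ne hay.symm])
    (by rw [hr, Finsupp.single_eq_same]; omega)

/-- A loss move from a one-wall state in a chart other than the wall letter is translated off the wall: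
`b_v(a) ≠ 0` (else the wall `u_a^M`, `M ≥ 1`, would be kept). [folklore] -/
theorem b_ne_zero_of_loss_wall (hroot : IsRoot q s₀) {v : ℕ} {a : Fin 3} {M : ℕ} (hM : 1 ≤ M)
    (hr : (W.st v).r = Finsupp.single a M) (hloss : IsLossMove W v) (hj : W.j v ≠ a) : W.b v a ≠ 0 := by
  classical
  intro hb
  obtain ⟨o, ho, -⟩ := walk_nat hroot W v
  have h := hloss a (Ne.symm hj)
  rw [r_succ_eq W v ho, Finsupp.add_apply, Finsupp.single_apply, if_neg hj, add_zero, kept_apply,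
    if_pos ⟨Ne.symm hj, hb⟩, hr, Finsupp.single_eq_same] at h
  omega

/-- **THE β-STEP (h2, chart = section letter) OF THE DATA SKELETON (PROVED):** from data `(a; x, y; μ)` at `v` and a
loss move in the chart `x`, the data `(x; a, y; κ)`, `κ = (b_v(y) − μ)/b_v(a)`, hold at `v+1` (`wall_pure_succ`) and
`B` does not increase (`betaOf_polyPts_straightened_succ_beta_le''` with `τ' := κ`, whose effective source parameter
`b_v(y) − κ·b_v(a)` IS `μ`). [new] -/
theorem wallSteps_h2_beta (hroot : IsRoot q s₀) (hT : TailHyp W N s)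
    (hLucas : ∀ D T : ℕ, q ∣ D → ¬ q ∣ T → ((D.choose T : ℕ) : K) = 0) {v : ℕ} {a x y : Fin 3} {μ : K}
    (hP : WallP W N s v ⟨a, x, y, μ⟩) (hloss : IsLossMove W v) (hj : W.j v = x) :
    WallP W N s (v + 1) ⟨x, a, y, (W.b v y - μ) / W.b v a⟩ ∧
      WallB W s (v + 1) ⟨x, a, y, (W.b v y - μ) / W.b v a⟩ ≤ WallB W s v ⟨a, x, y, μ⟩ := by
  classical
  obtain ⟨hax, hay, hxy, hNv, ⟨M, hr, hqM⟩, φ, hφ, hwall⟩ := hP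
  simp only at hax hay hxy hr hwall
  obtain ⟨T, hoT, h1T, hr1, hqT, -⟩ := lossMove_next hroot hT (by omega : N ≤ v) hloss
  rw [hj] at hr1
  have hsh : (W.st v).shade = (s : ℕ∞) := hT.shade v (by omega)
  have hplat : (W.st (v + 1)).shade = (W.st v).shade := by rw [hT.shade (v + 1) (by omega), hsh]
  have hsq := hT.s_lt
  have hM1 : 1 ≤ M := by omega
  have hga : W.b v a ≠ 0 := b_ne_zero_of_loss_wall hroot hM1 hr hloss (by rw [hj]; exact Ne.symm hax)
  -- `q + T = s + M`
  obtain ⟨o, ho, -⟩ := walk_nat hroot W v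
  obtain ⟨n, hn, hon⟩ := order_eq_shade_add_degree hroot W v ho
  have hns : n = s := by have h := hn.symm.trans hsh; exact_mod_cast h
  have hrdeg : (W.st v).r.degree = M := by rw [hr, Finsupp.degree_single]
  have hTq : q + T = M + s := by
    have h := ho.symm.trans hoT
    have h' : o = q + T := by exact_mod_cast h
    omega
  have hlt := le_degree_of_wall hroot hT (by omega : N ≤ v) hr
  refine ⟨⟨Ne.symm hax, hxy, hay, by omega, ⟨T, hr1, by omega⟩, bUnit W v * φ, mul_ne_zero (bUnit_ne_zero W v) hφ,
    fun E hE hEx => wall_pure_succ hroot W v hax hay hxy hj hr hsh hplat hqM hga hwall E hEx hE⟩, ?_⟩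
  unfold WallB
  simp only
  have h := betaOf_polyPts_straightened_succ_beta_le'' hroot W v hax hay hxy hj hLucas ((W.b v y - μ) / W.b v a)
    hTq hlt (by rw [hr, Finsupp.single_eq_same]) (by rw [hr, Finsupp.single_eq_of_ne hax.symm])
    (by rw [hr, Finsupp.single_eq_of_ne hay.symm]) (by rw [hr1, Finsupp.single_eq_same])
    (by rw [hr1, Finsupp.single_eq_of_ne hax]) (by rw [hr1, Finsupp.single_eq_of_ne (Ne.symm hxy)]) hga hsq
    (by omega) (by omega)
  have hμ : W.b v y - (W.b v y - μ) / W.b v a * W.b v a = μ := by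
    rw [div_mul_cancel₀ _ hga]; ring
  rw [hμ] at h
  exact h

/-- **THE DEGENERATE β-STEP (h2, chart = ceiling letter, root `0`) OF THE DATA SKELETON (PROVED):** from data
`(a; x, y; 0)` (in-wall slice `φ·u_y^s`) and a loss in the chart `y`, the data `(y; x, a; 0)` hold at `v+1`
(`wall_axis_succ`: the new slice is `∝ u_a^s`) and `B` does not increase (`betaOf_polyPts_succ_ceiling_le` (S4) on the
raw polygons). [new] -/
theorem wallSteps_h2_gamma0 (hroot : IsRoot q s₀) (hT : TailHyp W N s)
    (hLucas : ∀ D T : ℕ, q ∣ D → ¬ q ∣ T → ((D.choose T : ℕ) : K) = 0) {v : ℕ} {a x y : Fin 3}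
    (hP : WallP W N s v ⟨a, x, y, 0⟩) (hloss : IsLossMove W v) (hj : W.j v = y) :
    WallP W N s (v + 1) ⟨y, x, a, 0⟩ ∧ WallB W s (v + 1) ⟨y, x, a, 0⟩ ≤ WallB W s v ⟨a, x, y, 0⟩ := by
  classical
  obtain ⟨hax, hay, hxy, hNv, ⟨M, hr, hqM⟩, φ, hφ, hwall⟩ := hP
  simp only at hax hay hxy hr hwall
  simp only [C_0, zero_mul, sub_zero] at hwall
  obtain ⟨T, hoT, h1T, hr1, hqT, -⟩ := lossMove_next hroot hT (by omega : N ≤ v) hloss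
  rw [hj] at hr1
  have hsh : (W.st v).shade = (s : ℕ∞) := hT.shade v (by omega)
  have hplat : (W.st (v + 1)).shade = (W.st v).shade := by rw [hT.shade (v + 1) (by omega), hsh]
  have hsq := hT.s_lt
  have hM1 : 1 ≤ M := by omega
  have hga : W.b v a ≠ 0 := b_ne_zero_of_loss_wall hroot hM1 hr hloss (by rw [hj]; exact Ne.symm hay)
  obtain ⟨o, ho, -⟩ := walk_nat hroot W v
  obtain ⟨n, hn, hon⟩ := order_eq_shade_add_degree hroot W v ho
  have hns : n = s := by have h := hn.symm.trans hsh; exact_mod_cast h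
  have hrdeg : (W.st v).r.degree = M := by rw [hr, Finsupp.degree_single]
  have hTq : q + T = M + s := by
    have h := ho.symm.trans hoT
    have h' : o = q + T := by exact_mod_cast h
    omega
  have hlt := le_degree_of_wall hroot hT (by omega : N ≤ v) hr
  have hs0 : ((-W.b v a) ^ s : K) ≠ 0 := pow_ne_zero _ (neg_ne_zero.mpr hga)
  refine ⟨⟨hxy.symm, hay.symm, hax.symm, by omega, ⟨T, hr1, by omega⟩, bUnit W v * (φ / (-W.b v a) ^ s),
    mul_ne_zero (bUnit_ne_zero W v) (div_ne_zero hφ hs0), fun E hE hEy => ?_⟩, ?_⟩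
  · show coeff ((W.st (v + 1)).r + E) (W.st (v + 1)).F = _ * coeff E ((X a - C (0 : K) * X x) ^ s)
    rw [C_0, zero_mul, sub_zero]
    exact wall_axis_succ hroot W v hay hax (Ne.symm hxy) hj hr hsh hplat hqM hga hwall E hEy hE
  · unfold WallB
    show betaOf (polyPts s (W.st (v + 1)).r y x a (deletePthPowers q (shear a x (0 : K) (W.st (v + 1)).F))) ≤
      betaOf (polyPts s (W.st v).r a x y (deletePthPowers q (shear y x (0 : K) (W.st v).F)))
    have hne := polyPts_straightened_nonempty hroot W v hax hay hxy (0 : K) hLucas (s := s)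
      (by rw [hr, Finsupp.single_eq_same]; omega) (by rw [hr, Finsupp.single_eq_of_ne hay.symm])
    have hα := alphaOf_polyPts_straightened_lt_one hroot W v hax hay hxy (0 : K) hLucas (s := s)
      (by rw [hr, Finsupp.single_eq_same]; omega) (by rw [hr, Finsupp.single_eq_of_ne hay.symm])
    have hne₁ := polyPts_straightened_nonempty hroot W (v + 1) hxy.symm hay.symm hax.symm (0 : K) hLucas (s := s)
      (by rw [hr1, Finsupp.single_eq_same]; omega) (by rw [hr1, Finsupp.single_eq_of_ne hay])
    rw [shear_zero, deletePthPowers_walk hroot] at hne hα hne₁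
    rw [shear_zero, deletePthPowers_walk hroot, shear_zero, deletePthPowers_walk hroot]
    exact betaOf_polyPts_succ_ceiling_le hroot W v hax hay hxy hj hLucas hTq hlt
      (by rw [hr, Finsupp.single_eq_same]) (by rw [hr, Finsupp.single_eq_of_ne hax.symm])
      (by rw [hr, Finsupp.single_eq_of_ne hay.symm]) (by rw [hr1, Finsupp.single_eq_same])
      (by rw [hr1, Finsupp.single_eq_of_ne hay]) (by rw [hr1, Finsupp.single_eq_of_ne hxy]) hga hne hα hne₁

/-- **REORIENTATION OF THE DATA (PROVED):** for `μ ≠ 0` the data `(a; x, y; μ)` and `(a; y, x; μ⁻¹)` hold together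
(`wall_pure_reorient`) with the same `B` ((S3′) `betaOf_polyPts_two_frames_walk`). [new] -/
theorem wallP_reorient (hroot : IsRoot q s₀) (hT : TailHyp W N s)
    (hLucas : ∀ D T : ℕ, q ∣ D → ¬ q ∣ T → ((D.choose T : ℕ) : K) = 0) {v : ℕ} {a x y : Fin 3} {μ : K}
    (hμ : μ ≠ 0) (hP : WallP W N s v ⟨a, x, y, μ⟩) :
    WallP W N s v ⟨a, y, x, μ⁻¹⟩ ∧ WallB W s v ⟨a, y, x, μ⁻¹⟩ = WallB W s v ⟨a, x, y, μ⟩ := by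
  classical
  obtain ⟨hax, hay, hxy, hNv, ⟨M, hr, hqM⟩, φ, hφ, hwall⟩ := hP
  simp only at hax hay hxy hr hwall
  refine ⟨⟨hay, hax, hxy.symm, hNv, ⟨M, hr, hqM⟩, φ * (-μ) ^ s, mul_ne_zero hφ (pow_ne_zero _ (neg_ne_zero.mpr hμ)),
    wall_pure_reorient hμ hwall⟩, ?_⟩
  unfold WallB
  exact (betaOf_polyPts_two_frames_walk hroot W v hax hay hxy hLucas (inv_mul_cancel₀ hμ)
    (le_degree_of_wall hroot hT (by omega : N ≤ v) hr) (by rw [hr, Finsupp.single_eq_same])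
    (by rw [hr, Finsupp.single_eq_of_ne hax.symm]) (by rw [hr, Finsupp.single_eq_of_ne hay.symm])
    (by rw [hr, Finsupp.single_eq_same]; omega)).1

/-- **THE PROPAGATION STEP h2 OF THE DATA SKELETON (PROVED):** from data at `v` and a loss move at `v`, data at `v+1`
with `B` not increased — by the chart letter: wall letter (α-step, data kept), section letter (β-step), ceiling letter
with `μ ≠ 0` (reorient, then β-step) or `μ = 0` (degenerate step). [new] -/
theorem wallSteps_h2 (hroot : IsRoot q s₀) (hT : TailHyp W N s)
    (hLucas : ∀ D T : ℕ, q ∣ D → ¬ q ∣ T → ((D.choose T : ℕ) : K) = 0) {v : ℕ} (d : WallFrame K)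
    (hP : WallP W N s v d) (hloss : IsLossMove W v) :
    ∃ d' : WallFrame K, WallP W N s (v + 1) d' ∧ WallB W s (v + 1) d' ≤ WallB W s v d := by
  classical
  obtain ⟨a, x, y, μ⟩ := d
  have hax : a ≠ x := hP.1
  have hay : a ≠ y := hP.2.1
  have hxy : x ≠ y := hP.2.2.1
  rcases fin3_eq_or a x y (W.j v) hax hay hxy with hj | hj | hj
  · exact ⟨_, wallSteps_h2_alpha hroot hT hLucas _ hP hloss hj⟩
  · exact ⟨_, wallSteps_h2_beta hroot hT hLucas hP hloss hj⟩
  · by_cases hμ : μ = 0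
    · subst hμ
      exact ⟨_, wallSteps_h2_gamma0 hroot hT hLucas hP hloss hj⟩
    · obtain ⟨hP', hB'⟩ := wallP_reorient hroot hT hLucas hμ hP
      obtain ⟨h1, h2⟩ := wallSteps_h2_beta hroot hT hLucas hP' hloss hj
      exact ⟨_, h1, h2.trans hB'.le⟩

end ChainAssembly

end Summit.ResolutionOfSingularities.ResolutionOfSingularities.Theorems.LossEpisode
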